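import Mathlib
import Summits.ValiantsHypothesis.ValiantsHypothesis.Theses.ValuativeGCT

/-!
# `ValuativeGCT.ValuativeFlip` (stmt-ValiantsHypothesis-12624), line skew-restriction-rank — Stub 3 `stub_symBlowup_mem`

Functions on `End(ℂ^{m×m})` are polynomials in the variables `X (j, i)` (row slot `j : MatIdx m`,
matrix position `i = toLex (c, d) : MatIdx m`), so "row `j` of `A`" is the `m × m` matrix of linear
forms `X_j := (X (j, toLex (c, d)))_{c,d}`.  For blow-up data `T : MatIdx m → Mat_δ(ℂ)` the LEVEL-`δ`
BLOW-UP DETERMINANT is `F_T = det B_T`, `B_T = ∑_j T_j ⊗ X_j` the `(δm) × (δm)` matrix indexed by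
`Fin δ × Fin m` with entry `((a₁,a₂),(b₁,b₂)) ↦ ∑_j T_j a₁ b₁ · X (j, toLex (a₂, b₂))`, and the stub's
`G = G_T = F_T + F_{Tᵀ}` (`Tᵀ` blockwise) is its `τ`-symmetrisation.

Mathematics (all elementary matrix algebra over the polynomial ring):
* `G` is a form of degree `m * δ`: every entry of `B_T` is a linear form, and the determinant of a
  square matrix of linear forms is a form of degree the size `card (Fin δ × Fin m) = δm` of the matrix
  (Leibniz expansion);
* sandwich invariance: the substitution `X (j, i) ↦ ∑_l P i₁ l₁ Q l₂ i₂ X (j, l)` sends `X_j ↦ P X_j Q`,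
  hence `B_T = ∑_j T_j ⊗ X_j ↦ ∑_j T_j ⊗ (P X_j Q) = (1 ⊗ P) B_T (1 ⊗ Q)` (`Matrix.mul_kronecker_mul`),
  and `det (1 ⊗ P) = (det P)^δ = 1` (`Matrix.det_kronecker`), so each of `F_T`, `F_{Tᵀ}` is fixed;
* transpose invariance: `X (j, i) ↦ X (j, swap i)` maps `B_T` to `(B_{Tᵀ})ᵀ`, so it swaps `F_T` and
  `F_{Tᵀ}` (`Matrix.det_transpose`) and fixes their sum.
These are the level-`δ` semi-invariants of the `m²`-arrow Kronecker quiver (Schofield–van den Bergh,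
Domokos–Zubkov, Derksen–Weyman); only their membership in the explicit invariant space is used here.
The homogeneity helper is adapted from the tree's
`Literature.AlgebraicGeometry.DeterminantalHypersurfaces.isHomogeneous_det_of_linear` (not in this
file's import closure). [folklore]
-/

namespace Summit.ValiantsHypothesis.ValiantsHypothesis.Theorems.ValuativeFlip

open MvPolynomial
open scoped BigOperators Matrix Kronecker
open Literature.NumberTheory.DiophantineGeometry Literature.Computability.AlgebraicComplexity

-- `Summit.ValiantsHypothesis.ValiantsHypothesis.…` is the tree's mandated single-conjunct layout (Sub = Summit).
set_option linter.dupNamespace false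

noncomputable section

/-! ### Homogeneity -/

/-- The determinant of a square matrix of linear forms is a form of degree the size of the matrix
(Leibniz expansion `Matrix.det_apply`, `IsHomogeneous.prod/.sum`). [folklore] -/
theorem sbm_isHomogeneous_det_of_linear {σ : Type*} {S : Type*} [CommRing S] {ι : Type*} [Fintype ι]
    [DecidableEq ι] {Y : Matrix ι ι (MvPolynomial σ S)} (h : ∀ i j, (Y i j).IsHomogeneous 1) :
    Y.det.IsHomogeneous (Fintype.card ι) := by
  -- adapted from Literature.AlgebraicGeometry.DeterminantalHypersurfaces.isHomogeneous_det_of_linear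
  rw [Matrix.det_apply]
  refine IsHomogeneous.sum _ _ _ fun τ _ => ?_
  have hp : (∏ i, Y (τ i) i).IsHomogeneous (Fintype.card ι) := by
    have := IsHomogeneous.prod Finset.univ (fun i => Y (τ i) i) (fun _ => 1) fun i _ => h _ _
    simpa using this
  rw [Units.smul_def]
  exact (mem_homogeneousSubmodule _ _).mp
    (zsmul_mem ((mem_homogeneousSubmodule _ _).mpr hp) _)

/-- Every entry `∑_j T_j a₁ b₁ · X (j, toLex (a₂, b₂))` of the blow-up matrix `B_T` is a linear form.
[folklore] -/
theorem sbm_entry_isHomogeneous {m δ : ℕ} (T : MatIdx m → Matrix (Fin δ) (Fin δ) ℂ)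
    (a b : Fin δ × Fin m) :
    (∑ j : MatIdx m, T j a.1 b.1 • MvPolynomial.X (R := ℂ) (j, toLex (a.2, b.2)) :
      MvPolynomial (MatIdx m × MatIdx m) ℂ).IsHomogeneous 1 := by
  refine IsHomogeneous.sum _ _ _ fun j _ => ?_
  rw [smul_eq_C_mul]
  exact (isHomogeneous_X _ _).C_mul _

/-- The blow-up determinant `F_T = det B_T` is a form of degree `m * δ` (the size of `B_T` is
`card (Fin δ × Fin m) = δ m`). [folklore] -/
theorem sbm_det_isHomogeneous {m δ : ℕ} (T : MatIdx m → Matrix (Fin δ) (Fin δ) ℂ) :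
    (Matrix.of fun a b : Fin δ × Fin m =>
        ∑ j : MatIdx m, T j a.1 b.1 • MvPolynomial.X (R := ℂ) (j, toLex (a.2, b.2))).det.IsHomogeneous
      (m * δ) := by
  have h := sbm_isHomogeneous_det_of_linear
    (Y := Matrix.of fun a b : Fin δ × Fin m =>
        ∑ j : MatIdx m, T j a.1 b.1 • MvPolynomial.X (R := ℂ) (j, toLex (a.2, b.2)))
    fun a b => sbm_entry_isHomogeneous T a b
  rw [Fintype.card_prod, Fintype.card_fin, Fintype.card_fin, mul_comm] at h
  exact h

/-! ### The blow-up matrix as a Kronecker sum and the sandwich substitution -/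

/-- `B_T = ∑_j T_j ⊗ X_j`, with `T_j` mapped into the polynomial ring by `C` and
`X_j = (X (j, toLex (c, d)))_{c,d}`. [folklore] -/
theorem sbm_matrix_eq_sum_kronecker {m δ : ℕ} (T : MatIdx m → Matrix (Fin δ) (Fin δ) ℂ) :
    (Matrix.of fun a b : Fin δ × Fin m =>
        ∑ j : MatIdx m, T j a.1 b.1 • MvPolynomial.X (R := ℂ) (j, toLex (a.2, b.2))) =
      ∑ j : MatIdx m, (T j).map (C : ℂ →+* MvPolynomial (MatIdx m × MatIdx m) ℂ) ⊗ₖ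
        (Matrix.of fun c d : Fin m =>
          (MvPolynomial.X (R := ℂ) (j, toLex (c, d)) : MvPolynomial (MatIdx m × MatIdx m) ℂ)) := by
  refine Matrix.ext fun a b => ?_
  simp only [Matrix.of_apply, Matrix.sum_apply, Matrix.kroneckerMap_apply, Matrix.map_apply,
    smul_eq_C_mul]

/-- A `ℂ`-algebra endomorphism of the polynomial ring, applied entrywise, passes through a Kronecker
factor with constant entries. [folklore] -/
theorem sbm_mapMatrix_kronecker_C {σ : Type*} {ι κ : Type*} [Fintype ι] [Fintype κ] [DecidableEq ι]
    [DecidableEq κ] (f : MvPolynomial σ ℂ →ₐ[ℂ] MvPolynomial σ ℂ) (M : Matrix ι ι ℂ)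
    (N : Matrix κ κ (MvPolynomial σ ℂ)) :
    f.mapMatrix (M.map (C : ℂ →+* MvPolynomial σ ℂ) ⊗ₖ N) =
      M.map (C : ℂ →+* MvPolynomial σ ℂ) ⊗ₖ f.mapMatrix N := by
  refine Matrix.ext fun a b => ?_
  simp only [AlgHom.mapMatrix_apply, Matrix.map_apply, Matrix.kroneckerMap_apply, map_mul,
    MvPolynomial.algHom_C, MvPolynomial.algebraMap_eq]

/-- The row-wise sandwich substitution `X (j, i) ↦ ∑_l P i₁ l₁ Q l₂ i₂ X (j, l)` maps the matrix of
linear forms `X_j` to `P X_j Q`. [folklore] -/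
theorem sbm_mapMatrix_X_sandwich {m : ℕ} (P Q : Matrix (Fin m) (Fin m) ℂ) (j : MatIdx m) :
    (MvPolynomial.aeval (R := ℂ) (fun p : MatIdx m × MatIdx m =>
        ∑ l : MatIdx m, (P (ofLex p.2).1 (ofLex l).1 * Q (ofLex l).2 (ofLex p.2).2) •
          MvPolynomial.X (R := ℂ) (p.1, l))).mapMatrix
        (Matrix.of fun c d : Fin m =>
          (MvPolynomial.X (R := ℂ) (j, toLex (c, d)) : MvPolynomial (MatIdx m × MatIdx m) ℂ)) =
      P.map (C : ℂ →+* MvPolynomial (MatIdx m × MatIdx m) ℂ) *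
        (Matrix.of fun c d : Fin m =>
          (MvPolynomial.X (R := ℂ) (j, toLex (c, d)) : MvPolynomial (MatIdx m × MatIdx m) ℂ)) *
        Q.map (C : ℂ →+* MvPolynomial (MatIdx m × MatIdx m) ℂ) := by
  refine Matrix.ext fun c d => ?_
  rw [AlgHom.mapMatrix_apply, Matrix.map_apply, Matrix.of_apply, MvPolynomial.aeval_X]
  dsimp only
  rw [← Equiv.sum_comp (toLex : Fin m × Fin m ≃ MatIdx m), Fintype.sum_prod_type, Finset.sum_comm]
  simp only [Matrix.mul_apply, Matrix.map_apply, Matrix.of_apply, ofLex_toLex, Finset.sum_mul,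
    smul_eq_C_mul, map_mul]
  refine Finset.sum_congr rfl fun e _ => Finset.sum_congr rfl fun f _ => ?_
  ring

/-- **Sandwich on the blow-up matrix**: the row-wise sandwich substitution maps
`B_T = ∑_j T_j ⊗ X_j` to `∑_j T_j ⊗ (P X_j Q) = (1 ⊗ P) · B_T · (1 ⊗ Q)`
(`Matrix.mul_kronecker_mul`). [folklore] -/
theorem sbm_mapMatrix_sandwich {m δ : ℕ} (T : MatIdx m → Matrix (Fin δ) (Fin δ) ℂ)
    (P Q : Matrix (Fin m) (Fin m) ℂ) :
    (MvPolynomial.aeval (R := ℂ) (fun p : MatIdx m × MatIdx m =>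
        ∑ l : MatIdx m, (P (ofLex p.2).1 (ofLex l).1 * Q (ofLex l).2 (ofLex p.2).2) •
          MvPolynomial.X (R := ℂ) (p.1, l))).mapMatrix
        (Matrix.of fun a b : Fin δ × Fin m =>
          ∑ j : MatIdx m, T j a.1 b.1 • MvPolynomial.X (R := ℂ) (j, toLex (a.2, b.2))) =
      ((1 : Matrix (Fin δ) (Fin δ) (MvPolynomial (MatIdx m × MatIdx m) ℂ)) ⊗ₖ
          P.map (C : ℂ →+* MvPolynomial (MatIdx m × MatIdx m) ℂ)) *
        (Matrix.of fun a b : Fin δ × Fin m =>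
          ∑ j : MatIdx m, T j a.1 b.1 • MvPolynomial.X (R := ℂ) (j, toLex (a.2, b.2))) *
        ((1 : Matrix (Fin δ) (Fin δ) (MvPolynomial (MatIdx m × MatIdx m) ℂ)) ⊗ₖ
          Q.map (C : ℂ →+* MvPolynomial (MatIdx m × MatIdx m) ℂ)) := by
  rw [sbm_matrix_eq_sum_kronecker, map_sum, Finset.mul_sum, Finset.sum_mul]
  refine Finset.sum_congr rfl fun j _ => ?_
  rw [sbm_mapMatrix_kronecker_C, sbm_mapMatrix_X_sandwich, ← Matrix.mul_kronecker_mul,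
    ← Matrix.mul_kronecker_mul, Matrix.one_mul, Matrix.mul_one]

/-- **Sandwich invariance of `F_T`**: for `det P = det Q = 1` the row-wise sandwich substitution fixes
`F_T = det B_T`, since `det ((1 ⊗ P) B_T (1 ⊗ Q)) = (det P)^δ · det B_T · (det Q)^δ`
(`Matrix.det_mul`, `Matrix.det_kronecker`). [folklore] -/
theorem sbm_aeval_sandwich_det {m δ : ℕ} (T : MatIdx m → Matrix (Fin δ) (Fin δ) ℂ)
    (P Q : Matrix (Fin m) (Fin m) ℂ) (hP : P.det = 1) (hQ : Q.det = 1) :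
    MvPolynomial.aeval (R := ℂ) (fun p : MatIdx m × MatIdx m =>
        ∑ l : MatIdx m, (P (ofLex p.2).1 (ofLex l).1 * Q (ofLex l).2 (ofLex p.2).2) •
          MvPolynomial.X (R := ℂ) (p.1, l))
        (Matrix.of fun a b : Fin δ × Fin m =>
          ∑ j : MatIdx m, T j a.1 b.1 • MvPolynomial.X (R := ℂ) (j, toLex (a.2, b.2))).det =
      (Matrix.of fun a b : Fin δ × Fin m =>
          ∑ j : MatIdx m, T j a.1 b.1 • MvPolynomial.X (R := ℂ) (j, toLex (a.2, b.2))).det := by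
  have hP' : (P.map (C : ℂ →+* MvPolynomial (MatIdx m × MatIdx m) ℂ)).det = 1 := by
    rw [← RingHom.mapMatrix_apply, ← RingHom.map_det, hP, map_one]
  have hQ' : (Q.map (C : ℂ →+* MvPolynomial (MatIdx m × MatIdx m) ℂ)).det = 1 := by
    rw [← RingHom.mapMatrix_apply, ← RingHom.map_det, hQ, map_one]
  rw [AlgHom.map_det, sbm_mapMatrix_sandwich, Matrix.det_mul, Matrix.det_mul, Matrix.det_kronecker,
    Matrix.det_kronecker, Matrix.det_one, hP', hQ', one_pow, one_pow, one_mul, one_mul, mul_one]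

/-! ### The transpose substitution -/

/-- **Transpose on the blow-up matrix**: the row-wise transpose `X (j, i) ↦ X (j, swap i)` maps `B_T` to
the transpose of `B_{Tᵀ}` (`Tᵀ` blockwise): entrywise
`∑_j T_j a₁ b₁ X (j, toLex (b₂, a₂)) = (B_{Tᵀ})_{b a}`. [folklore] -/
theorem sbm_mapMatrix_transpose {m δ : ℕ} (T : MatIdx m → Matrix (Fin δ) (Fin δ) ℂ) :
    (MvPolynomial.aeval (R := ℂ) (fun p : MatIdx m × MatIdx m =>
        MvPolynomial.X (R := ℂ) (p.1, toLex ((ofLex p.2).2, (ofLex p.2).1)))).mapMatrix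
        (Matrix.of fun a b : Fin δ × Fin m =>
          ∑ j : MatIdx m, T j a.1 b.1 • MvPolynomial.X (R := ℂ) (j, toLex (a.2, b.2))) =
      (Matrix.of fun a b : Fin δ × Fin m =>
          ∑ j : MatIdx m, (T j)ᵀ a.1 b.1 • MvPolynomial.X (R := ℂ) (j, toLex (a.2, b.2)))ᵀ := by
  refine Matrix.ext fun a b => ?_
  simp only [AlgHom.mapMatrix_apply, Matrix.map_apply, Matrix.of_apply, Matrix.transpose_apply,
    map_sum, map_smul, MvPolynomial.aeval_X, ofLex_toLex]

/-- **The transpose swaps `F_T` and `F_{Tᵀ}`**: the row-wise transpose substitution maps `det B_T` to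
`det (B_{Tᵀ})ᵀ = det B_{Tᵀ}` (`Matrix.det_transpose`). [folklore] -/
theorem sbm_aeval_transpose_det {m δ : ℕ} (T : MatIdx m → Matrix (Fin δ) (Fin δ) ℂ) :
    MvPolynomial.aeval (R := ℂ) (fun p : MatIdx m × MatIdx m =>
        MvPolynomial.X (R := ℂ) (p.1, toLex ((ofLex p.2).2, (ofLex p.2).1)))
        (Matrix.of fun a b : Fin δ × Fin m =>
          ∑ j : MatIdx m, T j a.1 b.1 • MvPolynomial.X (R := ℂ) (j, toLex (a.2, b.2))).det =
      (Matrix.of fun a b : Fin δ × Fin m =>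
          ∑ j : MatIdx m, (T j)ᵀ a.1 b.1 • MvPolynomial.X (R := ℂ) (j, toLex (a.2, b.2))).det := by
  rw [AlgHom.map_det, sbm_mapMatrix_transpose, Matrix.det_transpose]

/-! ### The stub -/

/-- **Stub 3 — feeding lemma: τ-symmetrised level-`δ` blow-up determinants are explicit invariants of
degree `mδ`.**  For `T : MatIdx m → Mat_δ(ℂ)` (one `δ × δ` block per row slot) put
`F_T(A) = det(∑_j T_j ⊗ X_j)` — the determinant of the `δm × δm` matrix of linear forms
`((a₁,a₂),(b₁,b₂)) ↦ ∑_j T_j(a₁,b₁) · X (j, toLex (a₂, b₂))` — and `G_T = F_T + F_{Tᵀ}` (`Tᵀ` blockwise).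
Then `G_T` is homogeneous of degree `m * δ`, invariant under every row-wise unimodular sandwich
`X_j ↦ P X_j Q`, and invariant under the row-wise transpose.
Proof: `∑_j T_j ⊗ (P X_j Q) = (1 ⊗ P)(∑_j T_j ⊗ X_j)(1 ⊗ Q)` (`Matrix.mul_kronecker_mul`) and
`det (1_δ ⊗ P) = (det P)^δ = 1` (`Matrix.det_kronecker`), so both summands are sandwich-invariant
(`AlgHom.map_det` pushes the substitution inside the determinant); `∑_j T_j ⊗ X_jᵀ = (∑_j T_jᵀ ⊗ X_j)ᵀ`,
so the transpose swaps `F_T` and `F_{Tᵀ}` (`Matrix.det_transpose`); a determinant of linear forms of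
size `card (Fin δ × Fin m) = δm = mδ` is a form of that degree (`Matrix.det_apply` +
`IsHomogeneous.prod`/`sum`).  These are the level-`δ` Schofield–van den Bergh / Domokos–Zubkov /
Derksen–Weyman semi-invariants of the `m²`-arrow Kronecker quiver; only membership is used.
[doi:10.1007/bf01236060 Thm 1.1; arXiv:math/9907174; arXiv:1512.03531] -/
theorem stub_symBlowup_mem (m δ : ℕ) (T : MatIdx m → Matrix (Fin δ) (Fin δ) ℂ) :
    let G : MvPolynomial (MatIdx m × MatIdx m)
        ℂ :=
      (Matrix.of fun a b : Fin δ × Fin m =>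
          ∑ j : MatIdx m, T j a.1 b.1 • MvPolynomial.X (R := ℂ) (j, toLex (a.2, b.2))).det +
      (Matrix.of fun a b : Fin δ × Fin m =>
          ∑ j : MatIdx m, (T j)ᵀ a.1 b.1 • MvPolynomial.X (R := ℂ) (j, toLex (a.2, b.2))).det
    G.IsHomogeneous (m * δ) ∧
    (∀ P Q : Matrix (Fin m) (Fin m) ℂ, P.det = 1 → Q.det = 1 →
      MvPolynomial.aeval (R := ℂ) (fun p : MatIdx m × MatIdx m =>
        ∑ l : MatIdx m, (P (ofLex p.2).1 (ofLex l).1 * Q (ofLex l).2 (ofLex p.2).2) •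
          MvPolynomial.X (R := ℂ) (p.1, l)) G = G) ∧
    MvPolynomial.aeval (R := ℂ) (fun p : MatIdx m × MatIdx m =>
        MvPolynomial.X (R := ℂ) (p.1, toLex ((ofLex p.2).2, (ofLex p.2).1))) G = G := by
  intro G
  refine ⟨?_, ?_, ?_⟩
  · exact (sbm_det_isHomogeneous T).add (sbm_det_isHomogeneous fun j => (T j)ᵀ)
  · intro P Q hP hQ
    simp only [G, map_add]
    rw [sbm_aeval_sandwich_det T P Q hP hQ, sbm_aeval_sandwich_det (fun j => (T j)ᵀ) P Q hP hQ]
  · simp only [G, map_add]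
    rw [sbm_aeval_transpose_det T, sbm_aeval_transpose_det (fun j => (T j)ᵀ)]
    simp only [Matrix.transpose_transpose]
    exact add_comm _ _

end

end Summit.ValiantsHypothesis.ValiantsHypothesis.Theorems.ValuativeFlip
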